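/-
Copyright (c) 2026 the pub-hodgecm-mathlib formalisation cell (harness21).  Prover seat hodgecm-mathlib-K2E3-p23 (g7), HCML Track B «K2-LIT»,
h413 = `stmt-HodgeConjecture-24833`, line `K2_E3_EllipticInputs`, unit U12 «Characters», PART «SC» (ED. 2) leaf (SC-an)₂
`sig_K2E3SupercuspidalTruncatedCharAnalyticTwo`, road «FC₂» (dealer K2E3-plan (g4) D132): piece (FC-9)₂ — «(FC) at the place» ⇒ «ELL-WEIGHT at the place» for
`U(σ_w, Φ₂)(L_w)`, the `Fin 2` twin of ★ (FC-9) p857240 `K2E3EllWeightPlaceOfFinConj` (K2E5-p04 (g3)).  2026-09-04.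
-/
import Summits.HodgeConjecture.HodgeConjecture.Theorems.K2E3EllWeightPlaceOfFinConj   -- ★ (FC-9) p857240: the `Fin 3` original; brings ★ [M2a] place frame, ★ Lemma 14 at the model (generic `m`), ★ `exists_isCompact_subset_mul_of_isCompact_image_mk`, Urysohn
import Summits.HodgeConjecture.HodgeConjecture.Theorems.K2E3HC14EllU11Haar           -- ★ (K2E5-p15 g3): `locallyCompactSpace_unitary` for `U(σ, J)(K)`, `J ∈ M₂(K)`
import HarnessLib

/-!
# h413 ∕ Track B «K2-LIT», unit U12, PART «SC» leaf (SC-an)₂, road «FC₂» — (FC-9)₂: THE FINITE-CONJUGATION-MEASURE STATEMENT (FC)₂ AT THE PLACE PAYS THE ELLIPTIC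
# ORBITAL WEIGHT «ELL-WEIGHT»₂ AT THE PLACE, WITH `W_E(γ) := ∫ β(x γ x⁻¹) dx` FOR A URYSOHN BUMP `β` — ★ (FC-9) TOKEN FOR TOKEN WITH `Fin 3 ↦ Fin 2`
# (Harish-Chandra 1970, Part VI §8 Theorem 14 p. 60 — replaced on road FC by an `L²`-type finiteness; Part V §2 Lemma 14)

Cell `pub/hodgecm-mathlib`, crux H413 = `stmt-HodgeConjecture-24833`, route of record `HCCMUnconditional`; chair K2-lead (g2), dealer K2E3-plan (g4), architect K2E3-p25 (g3).
THEOREMS ONLY (no `def`, no `instance`, no `notation`, no named-fact hypothesis, no `sorry`); lane `--supports stmt-HodgeConjecture-24833 --as helper`, count-neutral.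
(FC)₂ enters as the ONE hypothesis `hFC` = (FC) AT THE PLACE `(L, w, μ)` for `U_w := U(σ_w, Φ₂)(L_w)`, in the shape of ★ `K2E3FinConjAssemblyTwo.finConj₂`'s conclusion.

THE PAYER (= ★ (FC-9) verbatim).  For `U := U(σ_w, Φ₂)(L_w)`, Haar `μ`, compact `S ⊆ U`: a Urysohn bump `f ∈ C_c(U, [0,1])`, `f = 1` on `S`, `β := ofReal ∘ f`,
**`W_E(γ) := (∫⁻ x, β (x γ x⁻¹) ∂μ).toReal`**.  (a) `0 ≤ W_E`.  (b) `W_E ∈ L¹_loc(μ)`: `Λ(γ) := ∫⁻ β(xγx⁻¹)` is Borel, `‖W_E‖ₑ ≤ 1_{Φ_β}·Λ`, so `∫⁻_C ‖W_E‖ₑ ≤ ∫⁻_{C ∩ Φ_β} Λ < ⊤`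
by `hFC` (`Mb := 1`).  (c) For `γ` regular with compact centraliser and a Borel `Θ ≤ Mb` vanishing off `S`: `Θ ≤ β·Mb`, hence `∫⁻ Θ(xγx⁻¹) ≤ Λ(γ)·Mb`, and `Λ(γ) < ⊤` — the
conjugation fibre `{x | xγx⁻¹ ∈ tsupport β} ⊆ C'·Z(γ)` is compact (Harish-Chandra's Lemma 14 at the model ★ `UnitaryGroupOfForm.isCompact_image_mk_setOf_exists_conj_mem_of_charpoly_separable`,
generic `m`, here `m := 2` with §0's `Φ₂` facts, + ★ `exists_isCompact_subset_mul_of_isCompact_image_mk`, `Z(γ)` compact) and `β ≤ 1` — so `Λ(γ) = ofReal(W_E γ)`.  §1 proves this at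
`(L, w, μ, S)` modulo `hFC`; §2 is the ∀-closed adapter **`ellWeightPlace_two_of_finConjPlace (hFCall : ∀ (L') … (μ') …, ‹(FC)₂ at (L', w', μ')›) : ‹«ELL-WEIGHT₂ at the place» ∀-closed›`** —
the antecedent currency of the (M5h)₂ engine letter of road «FC₂».

* §0 `over_two_hermitian`, `isUnit_det_over_two`; §1 `ellWeightPlace_two_of_finConj`; §2 `ellWeightPlace_two_of_finConjPlace`.

HONEST LABEL.  HC_CM is proved only modulo the 7 printed citations (2 remaining named inputs: hLiu418 = `stmt-HodgeConjecture-24832`, h413 = `stmt-HodgeConjecture-24833`)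
until rung 0 closes; count-neutral helper; (FC)₂ is NOT proved here (★ `finConj₂` is hypothesis-first on the 2 × 2 letters); (SC-an)₂ stays OPEN.

## References
* [HarishChandra1970] Harish-Chandra (notes by G. van Dijk), *Harmonic Analysis on Reductive p-adic Groups*, LNM 162 (1970), Part V §2 Lemma 14 p. 52; Part VI §8
  Theorem 14 p. 60; Part VII §3 pp. 70–73.
* [Rogawski1990] J. D. Rogawski, *Automorphic Representations of Unitary Groups in Three Variables*, Ann. of Math. Stud. 123 (1990), §1.9 p. 8, §7.3 p. 97, §12.5 p. 182.
* [Folland1995] G. B. Folland, *A Course in Abstract Harmonic Analysis* (1995), §2.4, §2.6.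
-/

set_option autoImplicit false
-- the mandated namespace repeats the single-problem summit's segment (`HodgeConjecture.HodgeConjecture`)
set_option linter.dupNamespace false

noncomputable section

open MeasureTheory Measure Set Filter Topology NumberField IsDedekindDomain
open scoped NNReal ENNReal Pointwise Matrix MatrixGroups WithZero
open ValuativeRel
open Literature.NumberTheory.Automorphic Literature.NumberTheory.Automorphic.UnitaryGroup Literature.NumberTheory.Rogawski1990
open Literature.NumberTheory.GaloisRepresentations Literature.NumberTheory.GaloisRepresentations.IsNonarchimedeanLocalField

namespace Summit.HodgeConjecture.HodgeConjecture.Cruxes.H413.K2E3EllWeightPlaceOfFinConjTwo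

/-! ## §0 The form `Φ₂` at the model: hermitian with unit determinant -/

/-- `Φ₂ = (StdForm.antidiagonal 2).over K` is `σ`-hermitian for ANY ring endomorphism `σ` (its entries are `0, 1`: ★ `StdForm.over_map`, ★ `StdForm.transpose_over`) — ★
`K2E3SupercuspModelFrameAtPlace.over_three_hermitian` at `2 × 2`. [cite: Rogawski1990, §1.9 p. 8] -/
theorem over_two_hermitian {K : Type*} [CommRing K] (σ : K →+* K) :
    (((StdForm.antidiagonal 2).over K).map σ)ᵀ = (StdForm.antidiagonal 2).over K := by
  rw [StdForm.over_map, StdForm.transpose_over]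

/-- `det Φ₂` is a unit (`Φ₂² = 1`, ★ `StdForm.isUnit_over`) — ★ `isUnit_det_over_three` at `2 × 2`. [cite: Rogawski1990, §1.9 p. 8] -/
theorem isUnit_det_over_two {K : Type*} [CommRing K] : IsUnit ((StdForm.antidiagonal 2).over K).det :=
  (Matrix.isUnit_iff_isUnit_det _).1 ((StdForm.antidiagonal 2).isUnit_over K)

/-! ## §1 At one place datum `(L, w, μ, S)`, modulo (FC) at `(L, w, μ)`: `W_E := ∫ β(x · x⁻¹)` -/
set_option maxHeartbeats 800000 in -- long statement on the one-place carrier and a measure-theoretic assembly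
/-- **(FC-9) — (FC) AT `(L, w, μ)` ⇒ «ELL-WEIGHT» AT `(L, w, μ, S)`** with `W_E(γ) := (∫⁻ x, β (x γ x⁻¹) ∂μ).toReal`, `β = ofReal ∘ f` for a Urysohn bump `f ∈ C_c(U,[0,1])`,
`f|_S = 1`: nonnegative; locally integrable because `‖W_E‖ₑ ≤ 1_{Φ_β} · Λ` and `∫⁻_{C ∩ Φ_β} Λ < ⊤` is (FC); and `∫⁻ Θ(xγx⁻¹) ≤ Λ(γ)·Mb = ofReal(W_E γ)·Mb` at every regular
`γ` with compact centraliser, the fibre `{x | xγx⁻¹ ∈ tsupport β}` being compact (Lemma 14 at the model, ★) so that `Λ(γ) < ⊤`.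
[cite: HarishChandra1970, Part V §2 Lemma 14 p. 52; Part VI §8 Theorem 14 p. 60; Part VII §3 pp. 70–73] [cite: Folland1995, §2.4, §2.6] [cite: Rogawski1990, §12.5 p. 182] -/
theorem ellWeightPlace_two_of_finConj (L : Type) [Field L] [NumberField L] [IsCMField L] {v : HeightOneSpectrum (𝓞 ↥(maximalRealSubfield L))}
    (w : UnitaryGroup.PlacesOver L v) (hw : IsCMField.complexConj L • w.1 = w.1)
    [MeasurableSpace ↥(unitaryGroupOfForm (galAdicCompletionMap (L := L) (IsCMField.complexConj L) hw) ((StdForm.antidiagonal 2).over (w.1.adicCompletion L)))]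
    [BorelSpace ↥(unitaryGroupOfForm (galAdicCompletionMap (L := L) (IsCMField.complexConj L) hw) ((StdForm.antidiagonal 2).over (w.1.adicCompletion L)))]
    (μ : Measure ↥(unitaryGroupOfForm (galAdicCompletionMap (L := L) (IsCMField.complexConj L) hw) ((StdForm.antidiagonal 2).over (w.1.adicCompletion L)))) [μ.IsHaarMeasure]
    (hFC : ∀ {C : Set ↥(unitaryGroupOfForm (galAdicCompletionMap (L := L) (IsCMField.complexConj L) hw) ((StdForm.antidiagonal 2).over (w.1.adicCompletion L)))}, IsCompact C →
      ∀ {β : ↥(unitaryGroupOfForm (galAdicCompletionMap (L := L) (IsCMField.complexConj L) hw) ((StdForm.antidiagonal 2).over (w.1.adicCompletion L))) → ℝ≥0∞},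
        Continuous β → IsCompact (tsupport β) → ∀ {Mb : ℝ≥0∞}, Mb ≠ ⊤ → (∀ g, β g ≤ Mb) →
          ∫⁻ g in C ∩ {g | ∫⁻ x, β (x * g * x⁻¹) ∂μ < ⊤}, ∫⁻ x, β (x * g * x⁻¹) ∂μ ∂μ < ⊤)
    {S : Set ↥(unitaryGroupOfForm (galAdicCompletionMap (L := L) (IsCMField.complexConj L) hw) ((StdForm.antidiagonal 2).over (w.1.adicCompletion L)))} (hS : IsCompact S) :
    ∃ W_E : ↥(unitaryGroupOfForm (galAdicCompletionMap (L := L) (IsCMField.complexConj L) hw) ((StdForm.antidiagonal 2).over (w.1.adicCompletion L))) → ℝ,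
      LocallyIntegrable W_E μ ∧ (∀ g, 0 ≤ W_E g) ∧
      ∀ γ : ↥(unitaryGroupOfForm (galAdicCompletionMap (L := L) (IsCMField.complexConj L) hw) ((StdForm.antidiagonal 2).over (w.1.adicCompletion L))),
        IsRegularElt (γ : GL (Fin 2) (w.1.adicCompletion L)) →
        IsCompact ((Subgroup.centralizer ({γ} : Set ↥(unitaryGroupOfForm (galAdicCompletionMap (L := L) (IsCMField.complexConj L) hw) ((StdForm.antidiagonal 2).over (w.1.adicCompletion L))))) :
            Set ↥(unitaryGroupOfForm (galAdicCompletionMap (L := L) (IsCMField.complexConj L) hw) ((StdForm.antidiagonal 2).over (w.1.adicCompletion L)))) →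
          ∀ Θ : ↥(unitaryGroupOfForm (galAdicCompletionMap (L := L) (IsCMField.complexConj L) hw) ((StdForm.antidiagonal 2).over (w.1.adicCompletion L))) → ℝ≥0∞,
            Measurable Θ → (∀ g, Θ g ≠ 0 → g ∈ S) → ∀ Mb : ℝ≥0∞, (∀ g, Θ g ≤ Mb) →
              ∫⁻ x, Θ (x * γ * x⁻¹) ∂μ ≤ ENNReal.ofReal (W_E γ) * Mb := by
  -- the frame of `L_w`, `GL₃(L_w)` and `U` (★ [M2a] FILE A; ★ `AdicCompletionLocalField`)
  haveI : SecondCountableTopology (w.1.adicCompletion L) := secondCountableTopology_adicCompletion L w.1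
  haveI : CharZero (w.1.adicCompletion L) := charZero_of_injective_algebraMap (algebraMap L (w.1.adicCompletion L)).injective
  haveI : SecondCountableTopology (GL (Fin 2) (w.1.adicCompletion L)) := secondCountableTopology_gl_adicCompletion L 2 w.1
  haveI : LocallyCompactSpace (GL (Fin 2) (w.1.adicCompletion L)) := locallyCompactSpace_gl_adicCompletion L 2 w.1
  haveI : SigmaCompactSpace (GL (Fin 2) (w.1.adicCompletion L)) := sigmaCompactSpace_of_locallyCompact_secondCountable
  haveI : SecondCountableTopology ↥(unitaryGroupOfForm (galAdicCompletionMap (L := L) (IsCMField.complexConj L) hw) ((StdForm.antidiagonal 2).over (w.1.adicCompletion L))) :=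
    K2E3SupercuspModelFrameAtPlace.secondCountableTopology_unitaryGroupOfForm_adicCompletion L w _ _
  haveI : LocallyCompactSpace ↥(unitaryGroupOfForm (galAdicCompletionMap (L := L) (IsCMField.complexConj L) hw) ((StdForm.antidiagonal 2).over (w.1.adicCompletion L))) :=
    K2E3HC14EllU11Haar.locallyCompactSpace_unitary (continuous_galAdicCompletionMap L (IsCMField.complexConj L) hw) _
  haveI : SigmaCompactSpace ↥(unitaryGroupOfForm (galAdicCompletionMap (L := L) (IsCMField.complexConj L) hw) ((StdForm.antidiagonal 2).over (w.1.adicCompletion L))) := sigmaCompactSpace_of_locallyCompact_secondCountable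
  have hσσ : ∀ x, galAdicCompletionMap (L := L) (IsCMField.complexConj L) hw (galAdicCompletionMap (L := L) (IsCMField.complexConj L) hw x) = x :=
    galAdicCompletionMap_galAdicCompletionMap_of_smul_eq (IsCMField.complexConj L) w (IsCMField.complexConj_ne_one L) hw
  have hσc : Continuous (galAdicCompletionMap (L := L) (IsCMField.complexConj L) hw) := continuous_galAdicCompletionMap L (IsCMField.complexConj L) hw
  -- the Urysohn bump `β = ofReal ∘ f`, `f ∈ C_c(U, [0,1])`, `f = 1` on `S`
  obtain ⟨f, hf1, -, hfcs, hf01⟩ := exists_continuous_one_zero_of_isCompact hS isClosed_empty (Set.disjoint_empty S)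
  obtain ⟨β, hβ⟩ : ∃ β : ↥(unitaryGroupOfForm (galAdicCompletionMap (L := L) (IsCMField.complexConj L) hw) ((StdForm.antidiagonal 2).over (w.1.adicCompletion L))) → ℝ≥0∞, ∀ g, β g = ENNReal.ofReal (f g) := ⟨_, fun _ => rfl⟩
  have hβf : β = fun g => ENNReal.ofReal (f g) := funext hβ
  have hβc : Continuous β := by rw [hβf]; exact ENNReal.continuous_ofReal.comp f.continuous
  have hβcs : HasCompactSupport β := by rw [hβf]; exact hfcs.comp_left ENNReal.ofReal_zero
  have hβ1 : ∀ g, β g ≤ 1 := fun g => by rw [hβ]; exact ENNReal.ofReal_le_one.2 (hf01 g).2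
  have hβS : ∀ g ∈ S, β g = 1 := fun g hg => by rw [hβ, hf1 hg, Pi.one_apply, ENNReal.ofReal_one]
  have hβconj : ∀ γ : ↥(unitaryGroupOfForm (galAdicCompletionMap (L := L) (IsCMField.complexConj L) hw) ((StdForm.antidiagonal 2).over (w.1.adicCompletion L))), Measurable fun x : ↥(unitaryGroupOfForm (galAdicCompletionMap (L := L) (IsCMField.complexConj L) hw) ((StdForm.antidiagonal 2).over (w.1.adicCompletion L))) => β (x * γ * x⁻¹) := fun γ =>
    (hβc.comp ((continuous_id.mul continuous_const).mul continuous_inv)).measurable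
  -- `Λ(γ) = ∫⁻ β(x γ x⁻¹)` is Borel; `Φ_β` is measurable
  have hΛm : Measurable fun g : ↥(unitaryGroupOfForm (galAdicCompletionMap (L := L) (IsCMField.complexConj L) hw) ((StdForm.antidiagonal 2).over (w.1.adicCompletion L))) => ∫⁻ x, β (x * g * x⁻¹) ∂μ :=
    Measurable.lintegral_prod_right (f := fun (g x : ↥(unitaryGroupOfForm (galAdicCompletionMap (L := L) (IsCMField.complexConj L) hw) ((StdForm.antidiagonal 2).over (w.1.adicCompletion L)))) => β (x * g * x⁻¹))
      (hβc.comp ((continuous_snd.mul continuous_fst).mul continuous_snd.inv)).measurable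
  have hΦm : MeasurableSet {g : ↥(unitaryGroupOfForm (galAdicCompletionMap (L := L) (IsCMField.complexConj L) hw) ((StdForm.antidiagonal 2).over (w.1.adicCompletion L))) | ∫⁻ x, β (x * g * x⁻¹) ∂μ < ⊤} := measurableSet_lt hΛm measurable_const
  refine ⟨fun γ => (∫⁻ x, β (x * γ * x⁻¹) ∂μ).toReal, ?_, fun γ => ENNReal.toReal_nonneg, ?_⟩
  · -- (b) local integrability from (FC)
    rw [locallyIntegrable_iff]
    intro C hC
    refine ⟨hΛm.ennreal_toReal.aestronglyMeasurable, ?_⟩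
    rw [hasFiniteIntegral_iff_enorm]
    have hle : ∀ γ : ↥(unitaryGroupOfForm (galAdicCompletionMap (L := L) (IsCMField.complexConj L) hw) ((StdForm.antidiagonal 2).over (w.1.adicCompletion L))), ‖(∫⁻ x, β (x * γ * x⁻¹) ∂μ).toReal‖ₑ ≤
        {g : ↥(unitaryGroupOfForm (galAdicCompletionMap (L := L) (IsCMField.complexConj L) hw) ((StdForm.antidiagonal 2).over (w.1.adicCompletion L))) | ∫⁻ x, β (x * g * x⁻¹) ∂μ < ⊤}.indicator (fun g => ∫⁻ x, β (x * g * x⁻¹) ∂μ) γ := fun γ => by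
      rw [Real.enorm_eq_ofReal ENNReal.toReal_nonneg]
      by_cases hγ : γ ∈ {g : ↥(unitaryGroupOfForm (galAdicCompletionMap (L := L) (IsCMField.complexConj L) hw) ((StdForm.antidiagonal 2).over (w.1.adicCompletion L))) | ∫⁻ x, β (x * g * x⁻¹) ∂μ < ⊤}
      · rw [Set.indicator_of_mem hγ]; exact ENNReal.ofReal_toReal_le
      · have hγ' : ¬ ∫⁻ x, β (x * γ * x⁻¹) ∂μ < ⊤ := hγ
        rw [Set.indicator_of_notMem hγ, eq_top_iff.2 (not_lt.1 hγ'), ENNReal.toReal_top, ENNReal.ofReal_zero]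
    calc ∫⁻ γ in C, ‖(∫⁻ x, β (x * γ * x⁻¹) ∂μ).toReal‖ₑ ∂μ
        ≤ ∫⁻ γ in C, {g : ↥(unitaryGroupOfForm (galAdicCompletionMap (L := L) (IsCMField.complexConj L) hw) ((StdForm.antidiagonal 2).over (w.1.adicCompletion L))) | ∫⁻ x, β (x * g * x⁻¹) ∂μ < ⊤}.indicator (fun g => ∫⁻ x, β (x * g * x⁻¹) ∂μ) γ ∂μ := lintegral_mono fun γ => hle γ
      _ = ∫⁻ γ in {g : ↥(unitaryGroupOfForm (galAdicCompletionMap (L := L) (IsCMField.complexConj L) hw) ((StdForm.antidiagonal 2).over (w.1.adicCompletion L))) | ∫⁻ x, β (x * g * x⁻¹) ∂μ < ⊤} ∩ C, ∫⁻ x, β (x * γ * x⁻¹) ∂μ ∂μ := setLIntegral_indicator hΦm _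
      _ = ∫⁻ γ in C ∩ {g : ↥(unitaryGroupOfForm (galAdicCompletionMap (L := L) (IsCMField.complexConj L) hw) ((StdForm.antidiagonal 2).over (w.1.adicCompletion L))) | ∫⁻ x, β (x * g * x⁻¹) ∂μ < ⊤}, ∫⁻ x, β (x * γ * x⁻¹) ∂μ ∂μ := by rw [Set.inter_comm]
      _ < ⊤ := hFC hC hβc hβcs ENNReal.one_ne_top hβ1
  · -- (c) the fibre bound at a regular `γ` with compact centraliser
    intro γ hreg hZ Θ _hΘm hΘS Mb hΘb
    have hΘβ : ∀ g, Θ g ≤ β g * Mb := fun g => by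
      by_cases h0 : Θ g = 0
      · rw [h0]; exact bot_le
      · rw [hβS g (hΘS g h0), one_mul]; exact hΘb g
    -- Harish-Chandra's Lemma 14 at the model (`K = {γ}`, `C = tsupport β`), then `Z(γ)` compact ⇒ the fibre is compact
    letI : NontriviallyNormedField (w.1.adicCompletion L) := Valued.toNontriviallyNormedField (w.1.adicCompletion L) (WithZero (Multiplicative ℤ))
    have hA := UnitaryGroupOfForm.isCompact_image_mk_setOf_exists_conj_mem_of_charpoly_separable (m := 2) two_ne_zero hσc hσσ
      ((over_two_hermitian (galAdicCompletionMap (L := L) (IsCMField.complexConj L) hw)))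
      isUnit_det_over_two γ hreg isCompact_singleton
      (Set.singleton_subset_iff.2 (Subgroup.mem_centralizer_singleton_iff.2 rfl)) (fun t' ht' => by rw [Set.mem_singleton_iff.1 ht']; exact hreg) hβcs.isCompact
    have hset : {x : ↥(unitaryGroupOfForm (galAdicCompletionMap (L := L) (IsCMField.complexConj L) hw) ((StdForm.antidiagonal 2).over (w.1.adicCompletion L))) |
        ∃ t' ∈ ({γ} : Set ↥(unitaryGroupOfForm (galAdicCompletionMap (L := L) (IsCMField.complexConj L) hw) ((StdForm.antidiagonal 2).over (w.1.adicCompletion L)))), x * t' * x⁻¹ ∈ tsupport β} = {x | x * γ * x⁻¹ ∈ tsupport β} := by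
      ext x; simp only [Set.mem_setOf_eq, Set.mem_singleton_iff, exists_eq_left]
    rw [hset] at hA
    obtain ⟨C, hC, hsub⟩ := K2E3UnipotentConjTwistBochner.exists_isCompact_subset_mul_of_isCompact_image_mk (Subgroup.centralizer {γ}) hA
    have hScl : IsClosed {x : ↥(unitaryGroupOfForm (galAdicCompletionMap (L := L) (IsCMField.complexConj L) hw) ((StdForm.antidiagonal 2).over (w.1.adicCompletion L))) | x * γ * x⁻¹ ∈ tsupport β} :=
      (isClosed_tsupport _).preimage ((continuous_id.mul continuous_const).mul continuous_inv)
    have hScpt : IsCompact {x : ↥(unitaryGroupOfForm (galAdicCompletionMap (L := L) (IsCMField.complexConj L) hw) ((StdForm.antidiagonal 2).over (w.1.adicCompletion L))) | x * γ * x⁻¹ ∈ tsupport β} := (hC.mul hZ).of_isClosed_subset hScl hsub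
    have hfin : ∫⁻ x, β (x * γ * x⁻¹) ∂μ < ⊤ := by
      have hle : ∀ x : ↥(unitaryGroupOfForm (galAdicCompletionMap (L := L) (IsCMField.complexConj L) hw) ((StdForm.antidiagonal 2).over (w.1.adicCompletion L))), β (x * γ * x⁻¹) ≤ {x : ↥(unitaryGroupOfForm (galAdicCompletionMap (L := L) (IsCMField.complexConj L) hw) ((StdForm.antidiagonal 2).over (w.1.adicCompletion L))) | x * γ * x⁻¹ ∈ tsupport β}.indicator 1 x := fun x => by
        by_cases hx : x ∈ {x : ↥(unitaryGroupOfForm (galAdicCompletionMap (L := L) (IsCMField.complexConj L) hw) ((StdForm.antidiagonal 2).over (w.1.adicCompletion L))) | x * γ * x⁻¹ ∈ tsupport β}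
        · rw [Set.indicator_of_mem hx, Pi.one_apply]; exact hβ1 _
        · rw [image_eq_zero_of_notMem_tsupport (f := β) hx]; exact bot_le
      calc ∫⁻ x, β (x * γ * x⁻¹) ∂μ ≤ ∫⁻ x, {x : ↥(unitaryGroupOfForm (galAdicCompletionMap (L := L) (IsCMField.complexConj L) hw) ((StdForm.antidiagonal 2).over (w.1.adicCompletion L))) | x * γ * x⁻¹ ∈ tsupport β}.indicator 1 x ∂μ := lintegral_mono hle
        _ = μ {x : ↥(unitaryGroupOfForm (galAdicCompletionMap (L := L) (IsCMField.complexConj L) hw) ((StdForm.antidiagonal 2).over (w.1.adicCompletion L))) | x * γ * x⁻¹ ∈ tsupport β} := lintegral_indicator_one hScl.measurableSet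
        _ < ⊤ := hScpt.measure_lt_top
    calc ∫⁻ x, Θ (x * γ * x⁻¹) ∂μ ≤ ∫⁻ x, β (x * γ * x⁻¹) * Mb ∂μ := lintegral_mono fun x => hΘβ _
      _ = (∫⁻ x, β (x * γ * x⁻¹) ∂μ) * Mb := lintegral_mul_const Mb (hβconj γ)
      _ = ENNReal.ofReal ((∫⁻ x, β (x * γ * x⁻¹) ∂μ).toReal) * Mb := by rw [ENNReal.ofReal_toReal hfin.ne]

/-! ## §2 The ∀-closed adapter: (FC) at every place datum pays «ELL-WEIGHT at the place» -/
set_option maxHeartbeats 800000 in -- long statement (two ∀-closed inputs) on the one-place carriers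
/-- **ROAD-FC PAYER, ∀-CLOSED — «(FC) at the place» (∀-closed over the cand-v2 frame `(L') [..] {v'} (w') (hw') [..] [..] (μ') [..]`) ⇒ «ELL-WEIGHT at the place» (∀-closed:
★ (M5h‴)'s binder `hEW`)**, so that `sigSCan_datum_of_ellWeightPlace L H (ellWeightPlace_of_finConjPlace hFCall) …` is the road-FC tie.  §1 at each datum.
[cite: HarishChandra1970, Part V §2 Lemma 14 p. 52; Part VII §3 pp. 70–73] [cite: Folland1995, §2.4, §2.6] -/
theorem ellWeightPlace_two_of_finConjPlace
    (hFCall : ∀ (L' : Type) [Field L'] [NumberField L'] [IsCMField L'] {v' : HeightOneSpectrum (𝓞 ↥(maximalRealSubfield L'))}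
      (w' : UnitaryGroup.PlacesOver L' v') (hw' : IsCMField.complexConj L' • w'.1 = w'.1)
      [MeasurableSpace ↥(unitaryGroupOfForm (galAdicCompletionMap (L := L') (IsCMField.complexConj L') hw') ((StdForm.antidiagonal 2).over (w'.1.adicCompletion L')))]
      [BorelSpace ↥(unitaryGroupOfForm (galAdicCompletionMap (L := L') (IsCMField.complexConj L') hw') ((StdForm.antidiagonal 2).over (w'.1.adicCompletion L')))]
      (μ' : Measure ↥(unitaryGroupOfForm (galAdicCompletionMap (L := L') (IsCMField.complexConj L') hw') ((StdForm.antidiagonal 2).over (w'.1.adicCompletion L')))) [μ'.IsHaarMeasure],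
      ∀ {C : Set ↥(unitaryGroupOfForm (galAdicCompletionMap (L := L') (IsCMField.complexConj L') hw') ((StdForm.antidiagonal 2).over (w'.1.adicCompletion L')))}, IsCompact C →
        ∀ {β : ↥(unitaryGroupOfForm (galAdicCompletionMap (L := L') (IsCMField.complexConj L') hw') ((StdForm.antidiagonal 2).over (w'.1.adicCompletion L'))) → ℝ≥0∞},
          Continuous β → IsCompact (tsupport β) → ∀ {Mb : ℝ≥0∞}, Mb ≠ ⊤ → (∀ g, β g ≤ Mb) →
            ∫⁻ g in C ∩ {g | ∫⁻ x, β (x * g * x⁻¹) ∂μ' < ⊤}, ∫⁻ x, β (x * g * x⁻¹) ∂μ' ∂μ' < ⊤)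
    (L : Type) [Field L] [NumberField L] [IsCMField L] {v : HeightOneSpectrum (𝓞 ↥(maximalRealSubfield L))}
    (w : UnitaryGroup.PlacesOver L v) (hw : IsCMField.complexConj L • w.1 = w.1)
    [MeasurableSpace ↥(unitaryGroupOfForm (galAdicCompletionMap (L := L) (IsCMField.complexConj L) hw) ((StdForm.antidiagonal 2).over (w.1.adicCompletion L)))]
    [BorelSpace ↥(unitaryGroupOfForm (galAdicCompletionMap (L := L) (IsCMField.complexConj L) hw) ((StdForm.antidiagonal 2).over (w.1.adicCompletion L)))]
    (μ : Measure ↥(unitaryGroupOfForm (galAdicCompletionMap (L := L) (IsCMField.complexConj L) hw) ((StdForm.antidiagonal 2).over (w.1.adicCompletion L)))) [μ.IsHaarMeasure]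
    {S : Set ↥(unitaryGroupOfForm (galAdicCompletionMap (L := L) (IsCMField.complexConj L) hw) ((StdForm.antidiagonal 2).over (w.1.adicCompletion L)))} (hS : IsCompact S) :
    ∃ W_E : ↥(unitaryGroupOfForm (galAdicCompletionMap (L := L) (IsCMField.complexConj L) hw) ((StdForm.antidiagonal 2).over (w.1.adicCompletion L))) → ℝ,
      LocallyIntegrable W_E μ ∧ (∀ g, 0 ≤ W_E g) ∧
      ∀ γ : ↥(unitaryGroupOfForm (galAdicCompletionMap (L := L) (IsCMField.complexConj L) hw) ((StdForm.antidiagonal 2).over (w.1.adicCompletion L))),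
        IsRegularElt (γ : GL (Fin 2) (w.1.adicCompletion L)) →
        IsCompact ((Subgroup.centralizer ({γ} : Set ↥(unitaryGroupOfForm (galAdicCompletionMap (L := L) (IsCMField.complexConj L) hw) ((StdForm.antidiagonal 2).over (w.1.adicCompletion L))))) :
            Set ↥(unitaryGroupOfForm (galAdicCompletionMap (L := L) (IsCMField.complexConj L) hw) ((StdForm.antidiagonal 2).over (w.1.adicCompletion L)))) →
          ∀ Θ : ↥(unitaryGroupOfForm (galAdicCompletionMap (L := L) (IsCMField.complexConj L) hw) ((StdForm.antidiagonal 2).over (w.1.adicCompletion L))) → ℝ≥0∞,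
            Measurable Θ → (∀ g, Θ g ≠ 0 → g ∈ S) → ∀ Mb : ℝ≥0∞, (∀ g, Θ g ≤ Mb) →
              ∫⁻ x, Θ (x * γ * x⁻¹) ∂μ ≤ ENNReal.ofReal (W_E γ) * Mb :=
  ellWeightPlace_two_of_finConj L w hw μ (fun hC _ hβ hβs _ hMb hβM => hFCall L w hw μ hC hβ hβs hMb hβM) hS

end Summit.HodgeConjecture.HodgeConjecture.Cruxes.H413.K2E3EllWeightPlaceOfFinConjTwo

end
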